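import Summits.BirchSwinnertonDyer.Rank1Residual.X4.LevelRaisingCongruenceIdeal
import Summits.BirchSwinnertonDyer.Rank1Residual.X4.OldSupportedHeckeOperators
import HarnessLib

/-!
# Ribet's level-raising congruence identity, abstract form: an old-supported Hecke operator acts on the old plane through `(𝒰² − 1)` (cell `b2b-bsdres`, seat additive-p4 gen 34, line V58 — K106 = K105 ∘ K104)

HONEST FRAMING (verbatim, cell `b2b-bsdres`): the goal of the cell is to DELETE the COMBINATION-SHAPED
residual classes for ALL analytic-rank `≤ 1` curves over `ℚ` — "full BSD formula for every rank `≤ 1`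
curve in class `C`" assembled STRICTLY from published theorems — so that the rank-`≤ 1` remainder
becomes exactly the CONSTRUCTION-SHAPED classes, which are TYPED (missing-input Props), NOT attempted;
this is not "finishing BSD". This file: PURE ALGEBRA (composition of `X4/OldSupportedHeckeOperators`
(K105, Lemma L1 of memo V58) with `X4/LevelRaisingCongruenceIdeal` (K104, Lemma L2)); no arithmetic
input, no conjecture, nothing booked; 0 defs.

## What is proved

`oldSupported_action_mem_etaIdeal_brandt`: in the Brandt-module normalisation (`𝒰 = !![0, -1; ℓ, T]`,
Atkin–Lehner-twisted Gram matrix `u = !![T, ℓ+1; ℓ+1, T]`), if a Hecke operator `t` on the level-`Mℓ`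
module `H′` is supported on the `ℓ`-old part in the saturated sense (`t(H′) ⊆ i(R²)`, Ihara), the
adjoint `i†` of the degeneracy map is surjective (dual Ihara) with `i† ∘ i = u`, and `t` acts on the old
plane `R²` through `a·1 + b·𝒰 ∈ R[𝒰]` (its transpose being the adjoint action), then
`a·1 + b·𝒰 = (c·1 + d·𝒰)·(𝒰² − 1)` for some `c, d ∈ R` — the identity "(K)" of memo V58 §3
(`A^D_{old}|_{old} ⊆ η₁·𝕋^{D,old}`, `η₁ = U_ℓ² − 1`), i.e. Ribet's `η_p = T_p² − ⟨p⟩` congruence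
ideal for the definite quaternion algebra with Eichler level. `oldSupported_action_mem_etaIdeal` is the
same in the modular-curve normalisation (`𝒰 = !![T, ℓ; -1, 0]`, `u = !![ℓ+1, T; T, ℓ+1]`).

## References

* K. A. Ribet, Invent. Math. 100 (1990) 431–476, §3 and (6.1). [cite: Ribet1990, §3, (6.1)]
* K. A. Ribet, Proc. ICM 1983 (1984), Thm. 4.1. [cite: Ribet1984ICM, Thm. 4.1]
* F. Diamond, "The refined conjecture of Serre" (Hong Kong 1993 volume), §§3–4. [cite: Diamond1995RefinedSerre, §§3–4]
-/

namespace Summit.BirchSwinnertonDyer.Rank1Residual.LevelLowering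

open Matrix

section EtaIdeal

variable {R : Type*} [CommRing R] {H' : Type*} [AddCommGroup H']

/-- **Memo V58, identity (K), Brandt normalisation.** An old-supported Hecke operator (saturated sense)
whose degeneracy adjoint is surjective with Gram matrix `u = !![T, ℓ+1; ℓ+1, T]`, acting on the old
plane through `a·1 + b·𝒰` with `𝒰 = !![0, -1; ℓ, T]` (the transpose of its adjoint matrix), satisfies
`a·1 + b·𝒰 ∈ (𝒰² − 1)·R[𝒰]`. [cite: Ribet1990, §3, (6.1)] [cite: Diamond1995RefinedSerre, §§3–4] -/
theorem oldSupported_action_mem_etaIdeal_brandt (T ℓ a b : R)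
    (i : (Fin 2 → R) →+ H') (idag : H' →+ (Fin 2 → R)) (t : H' →+ H')
    (t₂' : Matrix (Fin 2) (Fin 2) R)
    (hu : ∀ v, idag (i v) = (!![T, ℓ + 1; ℓ + 1, T] : Matrix (Fin 2) (Fin 2) R).mulVec v)
    (hadj : ∀ h, idag (t h) = t₂'.mulVec (idag h))
    (hsat : ∀ h, ∃ v, t h = i v)
    (hsurj : Function.Surjective idag)
    (hact : t₂'.transpose = a • (1 : Matrix (Fin 2) (Fin 2) R) + b • !![(0 : R), -1; ℓ, T]) :
    ∃ c d : R, a • (1 : Matrix (Fin 2) (Fin 2) R) + b • !![(0 : R), -1; ℓ, T] =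
        (c • (1 : Matrix (Fin 2) (Fin 2) R) + d • !![(0 : R), -1; ℓ, T]) *
          (!![(0 : R), -1; ℓ, T] * !![(0 : R), -1; ℓ, T] - 1) := by
  have husymm : (!![T, ℓ + 1; ℓ + 1, T] : Matrix (Fin 2) (Fin 2) R).transpose =
      !![T, ℓ + 1; ℓ + 1, T] := by
    ext i j; fin_cases i <;> fin_cases j <;> rfl
  obtain ⟨m, hm⟩ := oldSupported_action_mem_gramIdeal i idag t _ t₂' husymm hu hadj hsat hsurj
  exact (levelRaisingIdeal_iff_brandt T ℓ a b).mp ⟨m, by rw [← hact, hm]⟩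

/-- **Memo V58, identity (K), modular-curve normalisation** (`𝒰 = !![T, ℓ; -1, 0]`, untwisted Gram
matrix `u = !![ℓ+1, T; T, ℓ+1]`): the same conclusion `a·1 + b·𝒰 ∈ (𝒰² − 1)·R[𝒰]`.
[cite: Ribet1990, §3, (6.1)] [cite: Ribet1984ICM, Thm. 4.1] -/
theorem oldSupported_action_mem_etaIdeal (T ℓ a b : R)
    (i : (Fin 2 → R) →+ H') (idag : H' →+ (Fin 2 → R)) (t : H' →+ H')
    (t₂' : Matrix (Fin 2) (Fin 2) R)
    (hu : ∀ v, idag (i v) = (!![ℓ + 1, T; T, ℓ + 1] : Matrix (Fin 2) (Fin 2) R).mulVec v)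
    (hadj : ∀ h, idag (t h) = t₂'.mulVec (idag h))
    (hsat : ∀ h, ∃ v, t h = i v)
    (hsurj : Function.Surjective idag)
    (hact : t₂'.transpose = a • (1 : Matrix (Fin 2) (Fin 2) R) + b • !![T, ℓ; -1, 0]) :
    ∃ c d : R, a • (1 : Matrix (Fin 2) (Fin 2) R) + b • !![T, ℓ; -1, 0] =
        (c • (1 : Matrix (Fin 2) (Fin 2) R) + d • !![T, ℓ; -1, 0]) *
          (!![T, ℓ; -1, 0] * !![T, ℓ; -1, 0] - 1) := by
  have husymm : (!![ℓ + 1, T; T, ℓ + 1] : Matrix (Fin 2) (Fin 2) R).transpose =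
      !![ℓ + 1, T; T, ℓ + 1] := by
    ext i j; fin_cases i <;> fin_cases j <;> rfl
  obtain ⟨m, hm⟩ := oldSupported_action_mem_gramIdeal i idag t _ t₂' husymm hu hadj hsat hsurj
  exact (levelRaisingIdeal_iff T ℓ a b).mp ⟨m, by rw [← hact, hm]⟩

end EtaIdeal

end Summit.BirchSwinnertonDyer.Rank1Residual.LevelLowering
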